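import Summits.NavierStokesRegularity.NavierStokesRegularity.Theses.AxisymmetricExtremality
import Literature.Analysis.FluidPDE.AxisymmetricReflection

/-!
# Strategist s7 — crux `AxisymmetricKatoGlobal` (stmt-NavierStokesRegularity-15453)

Typed artefacts behind `STRATEGY-CENSUS-s7.md` (independent census, family `s`).

* § W  (weaker intermediate — the one switch WITH teeth, at ROUTE level): the deciding theorem
  `closes` consumes `AxisymmetricKatoGlobal` only on a Rusin–Šverák MINIMAL blow-up datum produced by
  `MinimalDatumPFold` + `PFoldToAxisymmetric`.  Running the Smith step with the DIHEDRAL 2-groups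
  `D_{2^k} = ⟨R_{2π/2^k}, σ⟩` (σ = meridian mirror `reflY`, an improper isometry of `O(3)`, which also
  acts on the minimal-data set) outputs an `O(2)`-equivariant minimal datum, i.e. axisymmetric AND
  mirror-equivariant, i.e. SWIRL-FREE (`IsAxisymmetric.hasNoSwirl_iff_reflY`, tree).  Then the crux is
  replaceable by `NoSwirlKatoGlobal` (Ladyzhenskaya / Ukhovskii–Yudovich 1968 in the Kato class —
  provable with printed tools), certified below by `closes_noSwirl` (same by-contradiction logic as the
  route's `closes`) and `hasNoSwirl_of_rot_of_mirror` (the replacement hypotheses force no swirl).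
* § D / § S / § N: the typed decomposition / strengthening / negation attempts recorded in the census,
  stated as `def … : Prop` only (no claims), plus the trivial direction
  `AxisymmetricKatoGlobal → NoSwirlKatoGlobal`.

Nothing here restates, weakens or re-files the crux; the crux decl is only USED by name.
-/

noncomputable section

-- single-conjunct summit: `Summit.<Summit>.<Problem>` repeats the name by the D-0017 layout
set_option linter.dupNamespace false

namespace Summit.NavierStokesRegularity.NavierStokesRegularity.Cruxes.AxisymmetricKatoGlobal.StrategistS7

open MeasureTheory
open Literature.Analysis.FluidPDE Literature.Analysis.FunctionSpaces
open Summit.NavierStokesRegularity.NavierStokesRegularity.Theses.AxisymmetricExtremality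

local notation "ℝ³" => EuclideanSpace ℝ (Fin 3)
local notation "H12" => HomSobolev (EuclideanSpace ℝ (Fin 3)) (EuclideanSpace ℂ (Fin 3)) (1 / 2 : ℝ)

/-! ### Vocabulary (verbatim sub-terms of the route file) -/

/-- Clay (A) fails at viscosity `ν`: the verbatim antecedent of `MinimalDatumPFold`. -/
def ClayFails (ν : ℝ) : Prop :=
  ∃ v₀ : ℝ³ → ℝ³, ContDiff ℝ (⊤ : ℕ∞) v₀ ∧ NSWave0.IsDivFree v₀ ∧ HasRapidSpatialDecay v₀ ∧
    ¬ ∃ (u : ℝ → ℝ³ → ℝ³) (p : ℝ → ℝ³ → ℝ), IsSmoothOnHalfSpace u ∧ IsSmoothOnHalfSpace p ∧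
      IsNavierStokesSolution ν 0 v₀ u p ∧ HasBoundedEnergy u

/-- Equivariance of `u₀` under the rotation `R_θ` about the `x 2`-axis, written out exactly as in
the route file (`= (u₀ (rotZ θ x) = rotZ θ (u₀ x))` by `rfl`). -/
def RotEquivariant (u₀ : ℝ³ → ℝ³) (θ : ℝ) : Prop :=
  ∀ x : ℝ³, u₀ (WithLp.toLp 2 ![Real.cos θ * x 0 - Real.sin θ * x 1,
      Real.sin θ * x 0 + Real.cos θ * x 1, x 2]) =
    WithLp.toLp 2 ![Real.cos θ * u₀ x 0 - Real.sin θ * u₀ x 1,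
      Real.sin θ * u₀ x 0 + Real.cos θ * u₀ x 1, u₀ x 2]

/-- Equivariance of `u₀` under the meridian mirror `σ (x₀,x₁,x₂) = (x₀,−x₁,x₂)` (= the tree's
`reflY`, unfolded; see `mirrorEquivariant_iff_reflY`). -/
def MirrorEquivariant (u₀ : ℝ³ → ℝ³) : Prop :=
  ∀ x : ℝ³, u₀ (WithLp.toLp 2 ![x 0, -x 1, x 2]) = WithLp.toLp 2 ![u₀ x 0, -(u₀ x 1), u₀ x 2]

/-! ### § W — the replacement cone (weaker intermediate for `closes`) -/

/-- Replacement for `MinimalDatumPFold` (same Smith-type bet, 2-groups instead of `Z_p`): if Clay (A)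
fails at `ν`, then for every `N` there is `k ≥ N` and a Rusin–Šverák minimal blow-up datum
equivariant under the dihedral 2-group `D_{2^k}` generated by `R_{2π/2^k}` and the mirror `σ`
(Smith theory for finite 2-groups needs only `F₂`-acyclicity of `M̂ = M/Sim`; AlldayPuppe1993 Ch. 3). -/
def MinimalDatumDihedral : Prop :=
  ∀ ν : ℝ, 0 < ν → ClayFails ν → ∀ N : ℕ, ∃ k : ℕ, N ≤ k ∧
    ∃ (u₀ : ℝ³ → ℝ³) (g : H12), IsMinimalBlowupDatum ν u₀ g ∧
      RotEquivariant u₀ (2 * Real.pi / (2 : ℝ) ^ k) ∧ MirrorEquivariant u₀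

/-- Replacement for `PFoldToAxisymmetric` (its proved four-stub proof re-run with the mirror carried
along: the closure of `⋃ₖ Z_{2^k}` is `SO(2)`, mirror-equivariance is closed under `L³` limits, and a
limiting mirror plane through the limiting axis is conjugated back to `{x₁ = 0}` by a rotation). -/
def DihedralToSwirlFree : Prop :=
  ∀ ν : ℝ, 0 < ν →
    (∀ N : ℕ, ∃ k : ℕ, N ≤ k ∧ ∃ (u₀ : ℝ³ → ℝ³) (g : H12), IsMinimalBlowupDatum ν u₀ g ∧
      RotEquivariant u₀ (2 * Real.pi / (2 : ℝ) ^ k) ∧ MirrorEquivariant u₀) →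
    ∃ (u₀ : ℝ³ → ℝ³) (g : H12), IsMinimalBlowupDatum ν u₀ g ∧
      (∀ θ : ℝ, RotEquivariant u₀ θ) ∧ MirrorEquivariant u₀

/-- Replacement for the crux: the SWIRL-FREE axisymmetric case of `AxisymmetricKatoGlobal`
(Ladyzhenskaya 1968 / Ukhovskii–Yudovich 1968 in the Kato `Ḣ^{1/2}` class: `η = ω_θ/r` obeys a
drift–diffusion law with a maximum principle for `t > 0`, no finite energy needed). Strictly weaker than
the crux (`noSwirlKatoGlobal_of_crux`) and sufficient for the summit together with the two items
above (`closes_noSwirl`). -/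
def NoSwirlKatoGlobal : Prop :=
  ∀ ν : ℝ, 0 < ν → ∀ (u₀ : ℝ³ → ℝ³) (g : H12), MemLp u₀ 3 volume →
    g.Represents (EuclideanSpace.complexify ∘ u₀) → IsWeaklyDivFree u₀ →
    (∀ θ : ℝ, RotEquivariant u₀ θ) → MirrorEquivariant u₀ → HasGlobalKatoSolution ν u₀

/-- The replacement cone decides the summit — same pure-logic shape as the route's `closes`
(by contradiction on the Clay conclusion; the crux `AxisymmetricKatoGlobal` is NOT a hypothesis). -/
theorem closes_noSwirl (h₂ : MinimalDatumDihedral) (h₄ : DihedralToSwirlFree)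
    (h₃ : NoSwirlKatoGlobal) : NavierStokesRegularity := by
  show Literature.NS.NavierStokesExistenceSmoothR3
  intro ν hν u₀ hsm hdiv hdec
  by_contra hno
  obtain ⟨u₁, g, hmin, hrot, hmir⟩ := h₄ ν hν (h₂ ν hν ⟨u₀, hsm, hdiv, hdec, hno⟩)
  obtain ⟨hL3, hrep, hdiv₁, -, hnot⟩ := hmin
  exact hnot (h₃ ν hν u₁ g hL3 hrep hdiv₁ hrot hmir)

/-- The crux implies its swirl-free case (the replacement is a WEAKENING, never a restatement). -/
theorem noSwirlKatoGlobal_of_crux (h : AxisymmetricKatoGlobal) : NoSwirlKatoGlobal :=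
  fun ν hν u₀ g hL3 hrep hdiv hrot _ => h ν hν u₀ g hL3 hrep hdiv (fun θ x => hrot θ x)

/-- The unfolded rotation clause is `IsAxisymmetric` on the nose. -/
theorem rotEquivariant_iff_isAxisymmetric (u₀ : ℝ³ → ℝ³) :
    (∀ θ : ℝ, RotEquivariant u₀ θ) ↔ IsAxisymmetric u₀ := Iff.rfl

/-- The unfolded mirror clause is `reflY`-equivariance on the nose. -/
theorem mirrorEquivariant_iff_reflY (u₀ : ℝ³ → ℝ³) :
    MirrorEquivariant u₀ ↔ ∀ x, u₀ (reflY x) = reflY (u₀ x) := Iff.rfl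

/-- WHY THE REPLACEMENT HAS TEETH: the hypotheses of `NoSwirlKatoGlobal` force the datum to be
axisymmetric WITHOUT swirl (tree: `IsAxisymmetric.hasNoSwirl_of_reflY_eq`,
Majda–Bertozzi §2.3.3) — the case settled since 1968, where `∂_z(Γ²)/r⁴ ≡ 0`. -/
theorem hasNoSwirl_of_rot_of_mirror {u₀ : ℝ³ → ℝ³} (hrot : ∀ θ : ℝ, RotEquivariant u₀ θ)
    (hmir : MirrorEquivariant u₀) : IsAxisymmetric u₀ ∧ HasNoSwirl u₀ :=
  ⟨(rotEquivariant_iff_isAxisymmetric u₀).1 hrot,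
    ((rotEquivariant_iff_isAxisymmetric u₀).1 hrot).hasNoSwirl_of_reflY_eq
      ((mirrorEquivariant_iff_reflY u₀).1 hmir)⟩

/-- Converse bookkeeping: an axisymmetric swirl-free datum satisfies the replacement hypotheses, so
`NoSwirlKatoGlobal` is exactly "axisymmetric no-swirl `Ḣ^{1/2}` data have global Kato solutions". -/
theorem rot_mirror_of_hasNoSwirl {u₀ : ℝ³ → ℝ³} (hax : IsAxisymmetric u₀) (hsw : HasNoSwirl u₀) :
    (∀ θ : ℝ, RotEquivariant u₀ θ) ∧ MirrorEquivariant u₀ :=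
  ⟨(rotEquivariant_iff_isAxisymmetric u₀).2 hax,
    (mirrorEquivariant_iff_reflY u₀).2 (hax.reflY_eq_of_hasNoSwirl hsw)⟩

/-! ### § D — decomposition attempts (typed; NOT claimed; see census for why each lacks teeth) -/

/-- D1 "by swirl size": the small-swirl half.  Scale-invariant smallness of the swirl ALONE is not
known to give global solutions (Chen–Fang–Zhang arXiv:1505.00905 Thm 1.2 needs `H²` data and a
threshold depending on energy-level norms); typed here with an absolute constant `ε ν`. -/
def SmallSwirlKatoGlobal : Prop :=
  ∃ ε : ℝ, 0 < ε ∧ ∀ ν : ℝ, 0 < ν → ∀ (u₀ : ℝ³ → ℝ³) (g : H12), MemLp u₀ 3 volume →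
    g.Represents (EuclideanSpace.complexify ∘ u₀) → IsWeaklyDivFree u₀ → IsAxisymmetric u₀ →
    (∀ x, |swirl u₀ x| ≤ ε * ν) → HasGlobalKatoSolution ν u₀

/-- D1, the complementary half — visibly the crux minus a thin slice (costume), recorded only to
make the no-leverage point checkable. -/
def LargeSwirlKatoGlobal : Prop :=
  ∀ ε : ℝ, 0 < ε → ∀ ν : ℝ, 0 < ν → ∀ (u₀ : ℝ³ → ℝ³) (g : H12), MemLp u₀ 3 volume →
    g.Represents (EuclideanSpace.complexify ∘ u₀) → IsWeaklyDivFree u₀ → IsAxisymmetric u₀ →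
    (∃ x, ε * ν < |swirl u₀ x|) → HasGlobalKatoSolution ν u₀

/-- The D1 split does assemble (by cases on `sup |Γ₀| ≤ ε ν`), which is exactly why it is a costume:
all the difficulty sits in `LargeSwirlKatoGlobal`. -/
theorem crux_of_swirlSplit (h₁ : SmallSwirlKatoGlobal) (h₂ : LargeSwirlKatoGlobal) :
    AxisymmetricKatoGlobal := by
  intro ν hν u₀ g hL3 hrep hdiv hax
  obtain ⟨ε, hε, hsmall⟩ := h₁
  by_cases hcase : ∀ x, |swirl u₀ x| ≤ ε * ν
  · exact hsmall ν hν u₀ g hL3 hrep hdiv hax hcase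
  · simp only [not_forall, not_le] at hcase
    exact h₂ ε hε ν hν u₀ g hL3 hrep hdiv hax hcase

/-! ### § S — strengthening attempt (typed; NOT claimed) -/

/-- S1: the crux with an a-priori CRITICAL bound along the flow (the Kenig–Koch / Gallagher–Koch–
Planchon shape: global Kato solution whose `L³` norm stays below a function of the datum's norm).
More rigid (admits induction on `A`), implies the crux by `And.left`; the census explains why the
rigidity buys nothing here (no conservation law ties `sup_t ‖u(t)‖` to `‖u₀‖` for Navier–Stokes). -/
def AxisymKatoGlobalAPriori : Prop :=
  ∃ F : ENNReal → ENNReal, (∀ a, a < ⊤ → F a < ⊤) ∧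
    ∀ ν : ℝ, 0 < ν → ∀ (u₀ : ℝ³ → ℝ³) (g : H12), MemLp u₀ 3 volume →
      g.Represents (EuclideanSpace.complexify ∘ u₀) → IsWeaklyDivFree u₀ → IsAxisymmetric u₀ →
      HasGlobalKatoSolution ν u₀ ∧
        ∀ u : ℝ → ℝ³ → ℝ³, IsGlobalMildSolution ν 0 u₀ u → ContinuousInLpOn (Set.Ici 0) 3 u →
          ∀ t : ℝ, 0 ≤ t → eLpNorm (u t) 3 volume ≤ F (eLpNorm u₀ 3 volume)

theorem crux_of_aPriori (h : AxisymKatoGlobalAPriori) : AxisymmetricKatoGlobal := by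
  obtain ⟨F, -, hF⟩ := h
  exact fun ν hν u₀ g hL3 hrep hdiv hax => (hF ν hν u₀ g hL3 hrep hdiv hax).1

/-! ### § N — negation attempt (typed; NOT claimed) -/

/-- N1: the counterexample the negation lens would have to build — an axisymmetric `Ḣ^{1/2}` datum
(necessarily with swirl, by § W) without a global Kato solution.  No rigorous mechanism exists
(Type I / self-similar / near-one DSS are excluded in this class; Hou's two-scale scenario is numerical,
and its constant-viscosity self-similar version needs dimension parameter `n ≳ 3.19`). -/
def AxisymBlowupDatumExists : Prop :=
  ∃ ν : ℝ, 0 < ν ∧ ∃ (u₀ : ℝ³ → ℝ³) (g : H12), MemLp u₀ 3 volume ∧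
    g.Represents (EuclideanSpace.complexify ∘ u₀) ∧ IsWeaklyDivFree u₀ ∧ IsAxisymmetric u₀ ∧
    ¬ HasGlobalKatoSolution ν u₀

theorem not_crux_of_blowupDatum (h : AxisymBlowupDatumExists) : ¬ AxisymmetricKatoGlobal := by
  rintro hc
  obtain ⟨ν, hν, u₀, g, hL3, hrep, hdiv, hax, hnot⟩ := h
  exact hnot (hc ν hν u₀ g hL3 hrep hdiv hax)

end Summit.NavierStokesRegularity.NavierStokesRegularity.Cruxes.AxisymmetricKatoGlobal.StrategistS7

end
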